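import Summits.CriticalPhenomena.PercolationContinuityZ3.Theorems.PercNearOneGluingNoHeavyLowerTailMajorityGluingQCert3SliceSound
import Summits.CriticalPhenomena.PercolationContinuityZ3.Theorems.PercNearOneGluingNoHeavyLowerTailMajorityGluingQCert3SixFourSl01
import Summits.CriticalPhenomena.PercolationContinuityZ3.Theorems.PercNearOneGluingNoHeavyLowerTailMajorityGluingQCert3SixFourSl02
import Summits.CriticalPhenomena.PercolationContinuityZ3.Theorems.PercNearOneGluingNoHeavyLowerTailMajorityGluingQCert3SixFourSl03
import Summits.CriticalPhenomena.PercolationContinuityZ3.Theorems.PercNearOneGluingNoHeavyLowerTailMajorityGluingQCert3SixFourSl04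
import Summits.CriticalPhenomena.PercolationContinuityZ3.Theorems.PercNearOneGluingNoHeavyLowerTailMajorityGluingQCert3SixFourSl05
import Summits.CriticalPhenomena.PercolationContinuityZ3.Theorems.PercNearOneGluingNoHeavyLowerTailMajorityGluingQCert3SixFourSl06
import Summits.CriticalPhenomena.PercolationContinuityZ3.Theorems.PercNearOneGluingNoHeavyLowerTailMajorityGluingQCert3SixFourSl07
import Summits.CriticalPhenomena.PercolationContinuityZ3.Theorems.PercNearOneGluingNoHeavyLowerTailMajorityGluingQCert3SixFourSl08
import Summits.CriticalPhenomena.PercolationContinuityZ3.Theorems.PercNearOneGluingNoHeavyLowerTailMajorityGluingQCert3SixFourSl09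
import Summits.CriticalPhenomena.PercolationContinuityZ3.Theorems.PercNearOneGluingNoHeavyLowerTailMajorityGluingQCert3SixFourSl10
import Summits.CriticalPhenomena.PercolationContinuityZ3.Theorems.PercNearOneGluingNoHeavyLowerTailMajorityGluingQCert3SixFourSl11
import Summits.CriticalPhenomena.PercolationContinuityZ3.Theorems.PercNearOneGluingNoHeavyLowerTailMajorityGluingQCert3SixFourSl12
import Summits.CriticalPhenomena.PercolationContinuityZ3.Theorems.PercNearOneGluingNoHeavyLowerTailMajorityGluingQCert3SixFourSl13
import Summits.CriticalPhenomena.PercolationContinuityZ3.Theorems.PercNearOneGluingNoHeavyLowerTailMajorityGluingQCert3SixFourSl14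
import Summits.CriticalPhenomena.PercolationContinuityZ3.Theorems.PercNearOneGluingNoHeavyLowerTailMajorityGluingQCert3SixFourSl15
import Summits.CriticalPhenomena.PercolationContinuityZ3.Theorems.PercNearOneGluingNoHeavyLowerTailMajorityGluingQCert3SixFourSl16
import Summits.CriticalPhenomena.PercolationContinuityZ3.Theorems.PercNearOneGluingNoHeavyLowerTailMajorityGluingQCert3SixFourSl17
import Summits.CriticalPhenomena.PercolationContinuityZ3.Theorems.PercNearOneGluingNoHeavyLowerTailMajorityGluingQCert3SixFourSl18
import Summits.CriticalPhenomena.PercolationContinuityZ3.Theorems.PercNearOneGluingNoHeavyLowerTailMajorityGluingQCert3SixFourSl19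
import Summits.CriticalPhenomena.PercolationContinuityZ3.Theorems.PercNearOneGluingNoHeavyLowerTailMajorityGluingQCert3SixFourSl20
import Summits.CriticalPhenomena.PercolationContinuityZ3.Theorems.PercNearOneGluingNoHeavyLowerTailMajorityGluingQCert3SixFourSl21
import Summits.CriticalPhenomena.PercolationContinuityZ3.Theorems.PercNearOneGluingNoHeavyLowerTailMajorityGluingQCert3SixFourSl22
import Summits.CriticalPhenomena.PercolationContinuityZ3.Theorems.PercNearOneGluingNoHeavyLowerTailMajorityGluingQCert3SixFourSl23
import Summits.CriticalPhenomena.PercolationContinuityZ3.Theorems.PercNearOneGluingNoHeavyLowerTailMajorityGluingQCert3SixFourSl24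
import Summits.CriticalPhenomena.PercolationContinuityZ3.Theorems.PercNearOneGluingNoHeavyLowerTailMajorityGluingQCert3SixFourSl25
import Summits.CriticalPhenomena.PercolationContinuityZ3.Theorems.PercNearOneGluingNoHeavyLowerTailMajorityGluingQCert3SixFourSl26
import Summits.CriticalPhenomena.PercolationContinuityZ3.Theorems.PercNearOneGluingNoHeavyLowerTailMajorityGluingQCert3SixFourSl27
import Summits.CriticalPhenomena.PercolationContinuityZ3.Theorems.PercNearOneGluingNoHeavyLowerTailMajorityGluingQCert3SixFourSl28
import Summits.CriticalPhenomena.PercolationContinuityZ3.Theorems.PercNearOneGluingNoHeavyLowerTailMajorityGluingQCert3SixFourSl29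
import Summits.CriticalPhenomena.PercolationContinuityZ3.Theorems.PercNearOneGluingNoHeavyLowerTailMajorityGluingQCert3SixFourSl30
import Summits.CriticalPhenomena.PercolationContinuityZ3.Theorems.PercNearOneGluingNoHeavyLowerTailMajorityGluingQCert3SixFourSl31
import Summits.CriticalPhenomena.PercolationContinuityZ3.Theorems.PercNearOneGluingNoHeavyLowerTailMajorityGluingQCert3SixFourSl32
import Summits.CriticalPhenomena.PercolationContinuityZ3.Theorems.PercNearOneGluingNoHeavyLowerTailMajorityGluingQCert3SixFourSl33
import HarnessLib

/-!
# The degree-3 certificate `sixFour3` PASSES: nonnegative evaluation from its 65 slice checks (lane prim-rate, constants-miner 1, gen 34; CANDIDATES §GEN-34 R329–R330)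

Support file for the closed crux `NoHeavyLowerTail` (stmt-CriticalPhenomena-4575), majority-gluing line.  Assembles the kernel-checked slices `sixFour3_slice_0 … _64`
(`…QCert3SixFourSl01–33`) through `Cert3.eval_nonneg_of_slices` (`…QCert3SliceSound`) and `sixFour3_checkW3` (`…QCert3SixFour`) into **`sixFour3_eval`**: the contribution list
of the degree-3 certificate `sixFour3` (`61/50` for four of six relays cut) evaluates nonnegatively at every nonnegative point.  Consumer: `…MajorityGluingEightCert3`
(`cut_of_eval3_count`).  No sorries.
-/

namespace Summit.CriticalPhenomena.PercolationContinuityZ3.Theorems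

namespace HubOnly
namespace QCert

/-- All 65 slices of `sixFour3` pass. -/
theorem sixFour3_slices : ∀ i₀ < sixFour3.NV, sixFour3.checkSlice i₀ 16 = true := by
  intro i₀ hi₀
  have h65 : i₀ < 65 := hi₀
  interval_cases i₀
  · exact sixFour3_slice_0
  · exact sixFour3_slice_1
  · exact sixFour3_slice_2
  · exact sixFour3_slice_3
  · exact sixFour3_slice_4
  · exact sixFour3_slice_5
  · exact sixFour3_slice_6
  · exact sixFour3_slice_7
  · exact sixFour3_slice_8
  · exact sixFour3_slice_9
  · exact sixFour3_slice_10
  · exact sixFour3_slice_11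
  · exact sixFour3_slice_12
  · exact sixFour3_slice_13
  · exact sixFour3_slice_14
  · exact sixFour3_slice_15
  · exact sixFour3_slice_16
  · exact sixFour3_slice_17
  · exact sixFour3_slice_18
  · exact sixFour3_slice_19
  · exact sixFour3_slice_20
  · exact sixFour3_slice_21
  · exact sixFour3_slice_22
  · exact sixFour3_slice_23
  · exact sixFour3_slice_24
  · exact sixFour3_slice_25
  · exact sixFour3_slice_26
  · exact sixFour3_slice_27
  · exact sixFour3_slice_28
  · exact sixFour3_slice_29
  · exact sixFour3_slice_30
  · exact sixFour3_slice_31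
  · exact sixFour3_slice_32
  · exact sixFour3_slice_33
  · exact sixFour3_slice_34
  · exact sixFour3_slice_35
  · exact sixFour3_slice_36
  · exact sixFour3_slice_37
  · exact sixFour3_slice_38
  · exact sixFour3_slice_39
  · exact sixFour3_slice_40
  · exact sixFour3_slice_41
  · exact sixFour3_slice_42
  · exact sixFour3_slice_43
  · exact sixFour3_slice_44
  · exact sixFour3_slice_45
  · exact sixFour3_slice_46
  · exact sixFour3_slice_47
  · exact sixFour3_slice_48
  · exact sixFour3_slice_49
  · exact sixFour3_slice_50
  · exact sixFour3_slice_51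
  · exact sixFour3_slice_52
  · exact sixFour3_slice_53
  · exact sixFour3_slice_54
  · exact sixFour3_slice_55
  · exact sixFour3_slice_56
  · exact sixFour3_slice_57
  · exact sixFour3_slice_58
  · exact sixFour3_slice_59
  · exact sixFour3_slice_60
  · exact sixFour3_slice_61
  · exact sixFour3_slice_62
  · exact sixFour3_slice_63
  · exact sixFour3_slice_64

/-- **The contribution list of the degree-3 certificate `sixFour3` evaluates nonnegatively** at every nonnegative point. -/
theorem sixFour3_eval : ∀ v : ℕ → ℝ, (∀ i, 0 ≤ v i) → 0 ≤ evalC (val3 sixFour3.NV v) sixFour3.contribs :=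
  sixFour3.eval_nonneg_of_slices sixFour3_checkW3 16 sixFour3_slices

end QCert
end HubOnly

end Summit.CriticalPhenomena.PercolationContinuityZ3.Theorems
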